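import Summits.HodgeConjecture.HodgeConjecture.Cruxes.BlochSeedDiscOne.SeedCheckerSplitBlockLetterBundle
import Literature.AlgebraicGeometry.Modules.DetClassOfIso
import Literature.AlgebraicGeometry.Modules.PullbackFrame
import Literature.AlgebraicGeometry.Modules.CechPicOfLocalRing
import Literature.AlgebraicGeometry.Modules.UnitCocyclePresented
import Literature.AlgebraicGeometry.Motives.AbelianVarietyEndDegreeBound
import Literature.AlgebraicGeometry.Motives.CartierDivisorCurveDegree
import Literature.AlgebraicGeometry.HodgeTheory.AlgebraicityLocusCurves
import Literature.AlgebraicGeometry.Motives.GaloisCoverPointDivisorPullback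
import Literature.AlgebraicGeometry.Motives.RatFnSpec
import Literature.AlgebraicGeometry.Motives.AbelianVarietyCubeProofs
import Literature.AlgebraicGeometry.Motives.AbelianVarietyLie
import Literature.NumberTheory.ComplexMultiplication.EllipticCurveIsogenyInvariants
import Summits.HodgeConjecture.HodgeConjecture.Cruxes.BlochSeedDiscOne.SeedCheckerSplitBlockDecSepWiring
import Literature.AlgebraicGeometry.AbelianVarieties.HomogeneousLineBundleMulPullback

/-!
line stmt-HodgeConjecture-18881 Cruxes/BlochSeedDiscOne/Lines/birth.lean 814a6a70c14e831a stub_rung_pad4_seedAt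

# OriginSeparatingReduction — v42.3's ONE typed obligation `SplitBlock.OriginSeparating` PROVED (`originSeparating_holds`), by reduction to
# the Néron–Severi classes of the letters in `Ȟ¹(S⁴, 𝒪^×)` and four intersection numbers on the CM curve
# (hsemireg-sheaf8-1 g10, 2026-08-31; director-hodge R19.889 (P′)(iii) third item ∕ R19.898; file name kept from v1.0, when it was a reduction only)

WHAT IS PROVED (sorry-free, axioms {propext, Classical.choice, Quot.sound}; no named fact is consumed — the theorem of the cube enters through the
tree's PROVED `AbelianVariety.cubicalStructure_linEquiv_holds`):
* §1 the class calculus of rank-one modules in the tree's Čech Picard group (`Modules.detClass`, iso-invariant, `⊗ ↦ ·`, `∨ ↦ ⁻¹`, `f^* ↦ f^*`,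
  `M^{⊗n} ↦ [M]ⁿ` — all tree theorems): `cls`, `cls_zpowLine : [zpowLine M n] = [M]ⁿ` (`n : ℤ`), `cls_pullLine`.
* §2 **THE CLASS OF A LETTER BUNDLE**: `cls_factorLine : [L_S(a,x,y)] = [H]ᵃ·[D₁]ˣ·[D₂]ʸ` and
  `cls_letterBundle : [letterBundle θ ψ Z] = ∏_f π_f^* [L_S(Z_f)]` in `Ȟ¹(S⁴, 𝒪^×)`.
* §2b THE FACTOR SECTIONS `σ_g : S → S⁴` (identity into slot `g`, the zero homomorphism elsewhere): `pullback_toSchemeHom_zero` (pull-back along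
  `0 : A → B` kills `Ȟ¹`: it factors through `Spec ℂ`, `CechPic.eq_one_of_isLocalRing`), `sect_padProj_self ∕ _ne`, and
  `pullback_sect_letterClass : σ_g^*[letterBundle Z] = [H]^{a_g}[D₁]^{x_g}[D₂]^{y_g}` ⟹ `letterClass_injective_of_factor` (`S⁴ ⟶ S`).
* §2c THE THREE TEST CURVES `E₀ → S`, `t ↦ (o,t), (t,t), (t,ψt)` (`axisCurve`, `diagCurve`, `graphCurve`): the twelve pull-backs of `[U], [V], [Δ], [Γ]`
  (`axis_U … graph_Graph`: `U ↦ 1, t, t`; `V ↦ t, t, ψ^*t`; `Δ ↦ (−1)^*t, 1, (1−ψ)^*t`; `Γ ↦ (−1)^*t, (ψ−1)^*t, 1`, with `t = [θ]`) — pure pull-back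
  bookkeeping in the preadditive category of abelian varieties (`prodLift_fst ∕ _snd`, `Preadditive.comp_sub`, §2b's zero ∕ identity lemmas).
* §2d THE DEGREE DATUM `DegreeDatum E₀ h1 ψ₀` (a degree homomorphism `d : Ȟ¹(E₀, 𝒪^×) →* ℤ` with the FIVE INTERSECTION NUMBERS `d[o] = 1`,
  `d (−1)^*[o] = d ψ₀^*[o] = 1`, `d (1−ψ₀)^*[o] = d (ψ₀−1)^*[o] = 2`) and, GIVEN one, the degrees of the factor class along the three curves:
  `deg_axis = a`, `deg_diag = 2a − 2x`, `deg_graph = 2a − 2y` ⟹ `letterClassS_injective_of_degreeDatum` (`omega`).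
* §2e THE DEGREE HOMOMORPHISM `degHom E₀ h1 : Ȟ¹(E₀, 𝒪^×) →* ℤ` CONSTRUCTED from the tree's curve degree (`Motives.CartierDivisor.degree` through
  `CechPic.exists_cechClass_eq`, well defined by `LinEquiv.degree_eq` at `height ⊤ = 1` = `height_top_eq_one_of_smoothCurve`), and THE FIRST
  NUMBER **`degZ_originLine : deg [𝒪(o)] = 1`** (`cls_originLine : [𝒪(o)] = [o]` by `UnitCocycle.detClass_lineBundle`; `CurvePlaces.degree_pointDivisor`
  + `residueDegree_pt`).
* §2f AUTOMORPHISM INVARIANCE: `degree_pullback_of_isIso` (`deg α^*D = deg D` for an automorphism `α`, via `CurvePlaces.degree_pullback_eq_finrank_mul`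
  with function-field degree `1`), `isIso_toSchemeHom_psi ∕ _neg_one` (`ψ₀`, `−1` are automorphisms), hence THE SECOND AND THIRD NUMBERS
  **`degHom_epb_originLine_of_isIso : deg α^*[o] = 1`**.
* §2g THE TWO ISOGENY NUMBERS **`isogenyNumbers_holds : deg (1 − ψ₀)^*[o] = deg (ψ₀ − 1)^*[o] = 2`**: `1 ∓ ψ₀ ≠ 0` (else `2·𝟙 = 0`, against
  `isIsogeny_zsmul_id_of_cast_ne_zero` + `not_isIsogeny_zero_of_dim_pos`), so they are isogenies (`isIsogeny_of_ne_zero`, elliptic curves over `ℂ`), hence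
  dominant; `exists_degZ_epb_eq_mul` (`deg φ^*γ = [K(E₀):φ^*K(E₀)]·deg γ`, `CurvePlaces.degree_pullback_eq_finrank_mul`) gives `deg (1−ψ₀)^*[o] = n`
  and — via `(1−ψ₀) ≫ ψ₀ = 1 + ψ₀`, `deg ψ₀^*[o] = 1` — `deg (1+ψ₀)^*[o] = n`; THE PARALLELOGRAM LAW `degZ_parallelogram :
  deg (1+ψ₀)^*[o] + deg (1−ψ₀)^*[o] = 4` is Mumford §6 Cor. 2 on divisor classes (`AbelianVariety.classMap_classPullback_cube` with the injective class
  map `D ↦ [𝒪(D)] ∈ Ȟ¹`, the tree's PROVED cubical structure `cubicalStructure_linEquiv_holds`, at `(f, g, h) = (1, ψ₀, −ψ₀)`, `classMap_classPullback_zero`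
  for `g + h = 0`) followed by degrees; so `2n = 4`, `n = 2`; and `ψ₀ − 1 = (1−ψ₀) ≫ (−1)` with `deg (−1)^*[o] = 1`.
* §3 THE CHAIN: `separating_of_letterClass_injective`, `originSeparating_of_originClassesInjective(S)`, `originSeparating_of_degreeData`,
  `originSeparating_of_intersectionNumbers`, `originSeparating_of_isogenyNumbers`, and **`originSeparating_holds : OriginSeparating`**.
* §4 v42.6 WIRING (director R19.906 ∕ R19.907 (O′)(iv); c5c8-1 g55's brief; the suggested separate file `OriginDecSeparatingWiring.lean` is FOLDED IN
  here as a section because the v2.0 olean was not yet rebuilt when this was checked): `degZ_pullback_hom_of_isHomogeneous` — **a homogeneous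
  (`Pic⁰`) line bundle on any abelian variety `B` has degree `0` along every homomorphism `κ : E₀ → B`** (Mumford §8 (iii),
  `AbelianVarieties.cechPic_pullback_hom_mul_detClass` at `(κ, −κ)`: `1 = 0^*[Q] = κ^*[Q]·(−κ)^*[Q]`, `−κ = (−1) ≫ κ`, `deg` invariant under `−1`);
  the twelve test homomorphisms `testHom ψ f j = ι_j ≫ σ_f`; **`degInvariant h1 ψ₀ : DecBlindInvariant (picZero E₀) (Fin 4 → Fin 3 → ℤ)`** (c5c8 v42.5's
  structure INSTANTIATED: `χ A = (deg κ_{f,j}^*[A])`, `iso` ← `cls_congr`, `tensor` ← `cls_tensorObj` + homomorphisms, `dec` ← the lemma above);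
  `chi_letterBundle`, `chi_separates` (the degree rows of §2d with the numbers of §2e–§2g); **`originDecSeparating_holds : OriginDecSeparating`**
  (`originDecSeparating_of_invariant`) and the cross-check `example : OriginSeparating` through `originSeparating_of_invariant`.
The intermediate `Prop`s `OriginClassesInjective(S)`, `OriginDegreeData`, `OriginIntersectionNumbers`, `OriginIsogenyNumbers` (all now theorems:
`originIsogenyNumbers_holds` and the chain) are kept as the named stages of the reduction.

CONSEQUENCE (bookkeeping, for the director): v42.3's relabel-kill `PinnedTo.cell_eq_P ∕ _N` for the ORIGIN pin `originLaw` AND v42.4's decorated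
relabel-kill for `originPicZeroLaw` (`DecSeparating (originModel …) (picZero E₀)`) are now UNCONDITIONAL — the
C-free pin names its cells; memo-213's `q = −1` residual and (F6′)(ii)'s «pending a label-pinning interface» are closed for line #2's row guard of
record (R19.889 (P′)(i)).  Nothing here is a statement about `stub_rung2a`, the crux `BlochSeedDiscOne` (18881), `SheafSeedGaussSq` (30548), H2,
HC_AV, HC_CM, № 4 or HC; no datum, design, block or seed is constructed.  No `sorry`, no `axiom`, no `instance` (one `attribute [local instance]`
on the theorem `isIntegral_anchor`, file-local), no notation.
-/

set_option linter.dupNamespace false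
set_option autoImplicit false

open CategoryTheory CategoryTheory.Limits AlgebraicGeometry Opposite MonoidalCategory CartesianMonoidalCategory Order
open Literature.AlgebraicGeometry Literature.AlgebraicGeometry.Motives Literature.AlgebraicGeometry.HodgeTheory
open Literature.AlgebraicGeometry.Modules Literature.AlgebraicGeometry.AbelianVarieties

noncomputable section

namespace Summit.HodgeConjecture.HodgeConjecture.Cruxes.BlochSeedDiscOne.SeedChecker.SplitBlock.OriginSep

open Summit.Ventures.HSemireg Summit.Ventures.HSemireg.Pad4Tower
open Summit.HodgeConjecture.HodgeConjecture.Cruxes.BlochSeedDiscOne.Anchor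
open Summit.HodgeConjecture.HodgeConjecture.Cruxes.BlochSeedDiscOne.SeedChecker.SplitBlock

/-! ## §1 The class of a rank-one module in `Ȟ¹(X, 𝒪_X^×)` and its calculus (tree theorems repackaged over `HasRank · 1`) -/

section Cls

variable {X Y : Scheme.{0}} {M N : X.Modules}

/-- the Čech Picard class of a rank-one module (`detClass` on the local-freeness witness `HasRank.isFiniteLocallyFree'`; by proof irrelevance the
value does not depend on the witness). -/
def cls (h : HasRank M 1) : CechPic X := detClass (HasRank.isFiniteLocallyFree' h)

theorem cls_eq_detClass (h : HasRank M 1) (h' : IsFiniteLocallyFree M) : cls h = detClass h' := rfl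

/-- isomorphic rank-one modules have the same class. -/
theorem cls_congr (φ : M ≅ N) (hM : HasRank M 1) (hN : HasRank N 1) : cls hM = cls hN :=
  detClass_eq_of_iso φ _ _

/-- `[M ⊗ N] = [M]·[N]`. -/
theorem cls_tensorObj (hM : HasRank M 1) (hN : HasRank N 1) : cls (hasRank_tensorObj_one hM hN) = cls hM * cls hN :=
  detClass_tensorObj_of_hasRank_one hM hN _ _ _

/-- `[M^∨] = [M]⁻¹`. -/
theorem cls_dual (hM : HasRank M 1) : cls (hasRank_dual hM) = (cls hM)⁻¹ :=
  detClass_dual' (HasRank.isFiniteLocallyFree' hM) _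

/-- `[M^{⊗n}] = [M]ⁿ`. -/
theorem cls_tensorPow (hM : HasRank M 1) (n : ℕ) : cls (hasRank_tensorPow_one hM n) = cls hM ^ n :=
  detClass_tensorPow hM (HasRank.isFiniteLocallyFree' hM) n _

/-- `[zpowLine M n] = [M]ⁿ` for every integer `n` (negative powers are powers of the dual). -/
theorem cls_zpowLine (hM : HasRank M 1) : ∀ n : ℤ, cls (hasRank_zpowLine hM n) = cls hM ^ n
  | (n : ℕ) => by
    rw [zpow_natCast]
    exact cls_tensorPow hM n
  | Int.negSucc n => by
    rw [zpow_negSucc, ← inv_pow]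
    show cls (hasRank_tensorPow_one (hasRank_dual hM) (n + 1)) = _
    rw [cls_tensorPow (hasRank_dual hM) (n + 1), cls_dual]

/-- `[f^* M] = f^*[M]`. -/
theorem cls_pullback (f : Y ⟶ X) (hM : HasRank M 1) : cls (hasRank_pullback f hM) = CechPic.pullback f (cls hM) :=
  detClass_pullback f (HasRank.isFiniteLocallyFree' hM)

end Cls

/-! ## §2 The class of a letter bundle -/

section LetterClass

variable {E₀ : AbelianVariety ℂ}

/-- `[pullLine φ M] = φ^*[M]`. -/
theorem cls_pullLine {A B : AbelianVariety ℂ} (φ : A ⟶ B) {M : B.X.left.Modules} (hM : HasRank M 1) :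
    cls (hasRank_pullLine φ hM) = CechPic.pullback (AbelianVariety.Hom.toSchemeHom φ) (cls hM) :=
  cls_pullback _ hM

/-- **`[L_S(a, x, y)] = [H]ᵃ · [D₁]ˣ · [D₂]ʸ`** in `Ȟ¹(S, 𝒪^×)`. -/
theorem cls_factorLine {θ : E₀.X.left.Modules} (hθ : HasRank θ 1) (ψ : E₀ ⟶ E₀) (b : BPoint) :
    cls (hasRank_factorLine hθ ψ b) =
      cls (hasRank_lineH hθ) ^ b.1 * cls (hasRank_lineD₁ hθ) ^ b.2.1 * cls (hasRank_lineD₂ hθ ψ) ^ b.2.2 := by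
  have h0 : cls (hasRank_factorLine hθ ψ b) =
      cls (hasRank_tensorObj_one (hasRank_tensorObj_one (hasRank_zpowLine (hasRank_lineH hθ) b.1)
        (hasRank_zpowLine (hasRank_lineD₁ hθ) b.2.1)) (hasRank_zpowLine (hasRank_lineD₂ hθ ψ) b.2.2)) := rfl
  rw [h0, cls_tensorObj (hasRank_tensorObj_one (hasRank_zpowLine (hasRank_lineH hθ) b.1) (hasRank_zpowLine (hasRank_lineD₁ hθ) b.2.1))
      (hasRank_zpowLine (hasRank_lineD₂ hθ ψ) b.2.2),
    cls_tensorObj (hasRank_zpowLine (hasRank_lineH hθ) b.1) (hasRank_zpowLine (hasRank_lineD₁ hθ) b.2.1),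
    cls_zpowLine (hasRank_lineH hθ), cls_zpowLine (hasRank_lineD₁ hθ), cls_zpowLine (hasRank_lineD₂ hθ ψ)]

/-- the factor class of a letter: `π_f^*[L_S(Z_f)]`. -/
def factorClass {θ : E₀.X.left.Modules} (hθ : HasRank θ 1) (ψ : E₀ ⟶ E₀) (f : Fin 4) (b : BPoint) : CechPic (pad4Anchor E₀).X.left :=
  CechPic.pullback (AbelianVariety.Hom.toSchemeHom (padProj E₀ f)) (cls (hasRank_factorLine hθ ψ b))

/-- **`[letterBundle θ ψ Z] = ∏_f π_f^*[L_S(Z_f)]`** in `Ȟ¹(S⁴, 𝒪^×)`. -/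
theorem cls_letterBundle {θ : E₀.X.left.Modules} (hθ : HasRank θ 1) (ψ : E₀ ⟶ E₀) (Z : MCell) :
    cls (hasRank_letterBundle hθ ψ Z) = ∏ f : Fin 4, factorClass hθ ψ f (Z f) := by
  rw [Fin.prod_univ_four]
  have h0 : cls (hasRank_letterBundle hθ ψ Z) =
      cls (hasRank_tensorObj_one (hasRank_tensorObj_one (hasRank_tensorObj_one
        (hasRank_pullLine (padProj E₀ 0) (hasRank_factorLine hθ ψ (Z 0))) (hasRank_pullLine (padProj E₀ 1) (hasRank_factorLine hθ ψ (Z 1))))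
        (hasRank_pullLine (padProj E₀ 2) (hasRank_factorLine hθ ψ (Z 2)))) (hasRank_pullLine (padProj E₀ 3) (hasRank_factorLine hθ ψ (Z 3)))) := rfl
  rw [h0, cls_tensorObj (hasRank_tensorObj_one (hasRank_tensorObj_one
        (hasRank_pullLine (padProj E₀ 0) (hasRank_factorLine hθ ψ (Z 0))) (hasRank_pullLine (padProj E₀ 1) (hasRank_factorLine hθ ψ (Z 1))))
        (hasRank_pullLine (padProj E₀ 2) (hasRank_factorLine hθ ψ (Z 2)))) (hasRank_pullLine (padProj E₀ 3) (hasRank_factorLine hθ ψ (Z 3))),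
    cls_tensorObj (hasRank_tensorObj_one
        (hasRank_pullLine (padProj E₀ 0) (hasRank_factorLine hθ ψ (Z 0))) (hasRank_pullLine (padProj E₀ 1) (hasRank_factorLine hθ ψ (Z 1))))
        (hasRank_pullLine (padProj E₀ 2) (hasRank_factorLine hθ ψ (Z 2))),
    cls_tensorObj (hasRank_pullLine (padProj E₀ 0) (hasRank_factorLine hθ ψ (Z 0))) (hasRank_pullLine (padProj E₀ 1) (hasRank_factorLine hθ ψ (Z 1))),
    cls_pullLine (padProj E₀ 0) (hasRank_factorLine hθ ψ (Z 0)), cls_pullLine (padProj E₀ 1) (hasRank_factorLine hθ ψ (Z 1)),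
    cls_pullLine (padProj E₀ 2) (hasRank_factorLine hθ ψ (Z 2)), cls_pullLine (padProj E₀ 3) (hasRank_factorLine hθ ψ (Z 3))]
  rfl

/-- **THE LETTER CLASS** `Z ↦ ∏_f π_f^*([H]^{a_f} [D₁]^{x_f} [D₂]^{y_f})`, written out. -/
def letterClass {θ : E₀.X.left.Modules} (hθ : HasRank θ 1) (ψ : E₀ ⟶ E₀) (Z : MCell) : CechPic (pad4Anchor E₀).X.left :=
  ∏ f : Fin 4, CechPic.pullback (AbelianVariety.Hom.toSchemeHom (padProj E₀ f))
    (cls (hasRank_lineH hθ) ^ (Z f).1 * cls (hasRank_lineD₁ hθ) ^ (Z f).2.1 * cls (hasRank_lineD₂ hθ ψ) ^ (Z f).2.2)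

theorem cls_letterBundle_eq_letterClass {θ : E₀.X.left.Modules} (hθ : HasRank θ 1) (ψ : E₀ ⟶ E₀) (Z : MCell) :
    cls (hasRank_letterBundle hθ ψ Z) = letterClass hθ ψ Z := by
  rw [cls_letterBundle hθ ψ]
  unfold letterClass factorClass
  exact Finset.prod_congr rfl fun f _ => by rw [cls_factorLine hθ ψ]

end LetterClass


/-! ## §2b Restriction to one factor: the sections `σ_g : S → S⁴` kill the other three factors (`S⁴ ⟶ S` reduction) -/

section Sections

open scoped MonObj

variable {E₀ : AbelianVariety ℂ}

/-- the constant morphism at the unit on underlying schemes factors through `Spec ℂ`: `(1 : T → B).left = (T → Spec ℂ) ≫ e_B`. -/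
theorem one_left_eq {K : Type} [Field K] (T : SchemeOver K) (B : AbelianVariety K) : (1 : T ⟶ B.X).left = T.hom ≫ (η[B.X]).left := by
  rw [Hom.one_def, Over.comp_left]
  exact congrArg (· ≫ (η[B.X]).left) ((Category.comp_id _).symm.trans (Over.w (toUnit T)))

/-- **pull-back along the ZERO homomorphism kills every class** (it factors through `Spec ℂ`, a local ring: `CechPic.eq_one_of_isLocalRing`). -/
theorem pullback_toSchemeHom_zero {K : Type} [Field K] {A B : AbelianVariety K} (c : CechPic B.X.left) :
    CechPic.pullback (AbelianVariety.Hom.toSchemeHom (0 : A ⟶ B)) c = 1 := by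
  rw [AbelianVariety.toSchemeHom_zero_eq_one_left, one_left_eq, CechPic.pullback_comp]
  convert map_one (CechPic.pullback (Over.hom A.X)) using 2
  exact CechPic.eq_one_of_isLocalRing _

/-- pull-back along the identity homomorphism is the identity. -/
theorem pullback_toSchemeHom_id {K : Type} [Field K] {A : AbelianVariety K} (c : CechPic A.X.left) :
    CechPic.pullback (AbelianVariety.Hom.toSchemeHom (𝟙 A)) c = c := by
  change CechPic.pullback (𝟙 A.X.left) c = c
  simp

theorem toSchemeHom_comp {K : Type} [Field K] {A B C : AbelianVariety K} (f : A ⟶ B) (g : B ⟶ C) :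
    AbelianVariety.Hom.toSchemeHom (f ≫ g) = AbelianVariety.Hom.toSchemeHom f ≫ AbelianVariety.Hom.toSchemeHom g := rfl

variable (E₀) in
/-- **the factor sections `σ_g : S → S⁴ = ((S × S) × S) × S`**: the identity into slot `g`, the origin (zero homomorphism) into the other slots. -/
def sect : Fin 4 → (weilSurf E₀ ⟶ pad4Anchor E₀)
  | ⟨0, _⟩ => AbelianVariety.prodLift (AbelianVariety.prodLift (AbelianVariety.prodLift (𝟙 _) 0) 0) 0
  | ⟨1, _⟩ => AbelianVariety.prodLift (AbelianVariety.prodLift (AbelianVariety.prodLift 0 (𝟙 _)) 0) 0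
  | ⟨2, _⟩ => AbelianVariety.prodLift (AbelianVariety.prodLift 0 (𝟙 _)) 0
  | ⟨_ + 3, _⟩ => AbelianVariety.prodLift 0 (𝟙 _)

/-- `σ_g ≫ π_g = 𝟙`. -/
theorem sect_padProj_self (g : Fin 4) : sect E₀ g ≫ padProj E₀ g = 𝟙 _ := by
  fin_cases g <;>
    simp [sect, padProj, AbelianVariety.prodLift_fst, AbelianVariety.prodLift_snd, ← Category.assoc]

/-- `σ_g ≫ π_f = 0` for `f ≠ g`. -/
theorem sect_padProj_ne {g f : Fin 4} (h : f ≠ g) : sect E₀ g ≫ padProj E₀ f = 0 := by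
  fin_cases g <;> fin_cases f <;> first
    | exact absurd rfl h
    | simp [sect, padProj, AbelianVariety.prodLift_fst, AbelianVariety.prodLift_snd, ← Category.assoc]

/-- **THE FACTOR CLASS ON `S`**: `b = (a, x, y) ↦ [H]ᵃ · [D₁]ˣ · [D₂]ʸ ∈ Ȟ¹(S, 𝒪^×)`. -/
def letterClassS {θ : E₀.X.left.Modules} (hθ : HasRank θ 1) (ψ : E₀ ⟶ E₀) (b : BPoint) : CechPic (weilSurf E₀).X.left :=
  cls (hasRank_lineH hθ) ^ b.1 * cls (hasRank_lineD₁ hθ) ^ b.2.1 * cls (hasRank_lineD₂ hθ ψ) ^ b.2.2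

theorem letterClass_eq_prod {θ : E₀.X.left.Modules} (hθ : HasRank θ 1) (ψ : E₀ ⟶ E₀) (Z : MCell) :
    letterClass hθ ψ Z = ∏ f : Fin 4, CechPic.pullback (AbelianVariety.Hom.toSchemeHom (padProj E₀ f)) (letterClassS hθ ψ (Z f)) := rfl

/-- **RESTRICTING THE LETTER CLASS TO THE `g`-TH FACTOR**: `σ_g^*[letterBundle Z] = [L_S(Z_g)]` — the three other factors die. -/
theorem pullback_sect_letterClass {θ : E₀.X.left.Modules} (hθ : HasRank θ 1) (ψ : E₀ ⟶ E₀) (Z : MCell) (g : Fin 4) :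
    CechPic.pullback (AbelianVariety.Hom.toSchemeHom (sect E₀ g)) (letterClass hθ ψ Z) = letterClassS hθ ψ (Z g) := by
  rw [letterClass_eq_prod, map_prod]
  rw [Finset.prod_eq_single g]
  · rw [← CechPic.pullback_comp, ← toSchemeHom_comp, sect_padProj_self, pullback_toSchemeHom_id]
  · intro f _ hfg
    rw [← CechPic.pullback_comp, ← toSchemeHom_comp, sect_padProj_ne hfg, pullback_toSchemeHom_zero]
  · intro hg
    exact absurd (Finset.mem_univ g) hg

/-- **`S⁴ ⟶ S`**: injectivity of the factor class on `S` gives injectivity of the letter class on `S⁴`. -/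
theorem letterClass_injective_of_factor {θ : E₀.X.left.Modules} (hθ : HasRank θ 1) (ψ : E₀ ⟶ E₀)
    (hinj : Function.Injective (letterClassS hθ ψ)) : Function.Injective (letterClass hθ ψ) := by
  intro Z Z' h
  funext g
  apply hinj
  rw [← pullback_sect_letterClass hθ ψ Z g, ← pullback_sect_letterClass hθ ψ Z' g, h]

end Sections

/-! ## §2c Restriction to the three test curves `E₀ → S`: `t ↦ (o,t)`, `t ↦ (t,t)`, `t ↦ (t, ψ t)` (`S ⟶ E₀` bookkeeping) -/

section Curves

variable {E₀ : AbelianVariety ℂ}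

variable (E₀) in
/-- the axis curve `t ↦ (o, t)`. -/
def axisCurve : E₀ ⟶ weilSurf E₀ := AbelianVariety.prodLift 0 (𝟙 E₀)

variable (E₀) in
/-- the diagonal `t ↦ (t, t)`. -/
def diagCurve : E₀ ⟶ weilSurf E₀ := AbelianVariety.prodLift (𝟙 E₀) (𝟙 E₀)

/-- the graph `t ↦ (t, ψ t)`. -/
def graphCurve (ψ : E₀ ⟶ E₀) : E₀ ⟶ weilSurf E₀ := AbelianVariety.prodLift (𝟙 E₀) ψ

/-- pull-back of a class on `E₀` along an endomorphism `φ`. -/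
abbrev epb (φ : E₀ ⟶ E₀) (c : CechPic E₀.X.left) : CechPic E₀.X.left := CechPic.pullback (AbelianVariety.Hom.toSchemeHom φ) c

/-- pull-back of a class on `S` along a curve `ι : E₀ → S`. -/
abbrev cpb (ι : E₀ ⟶ weilSurf E₀) (c : CechPic (weilSurf E₀).X.left) : CechPic E₀.X.left :=
  CechPic.pullback (AbelianVariety.Hom.toSchemeHom ι) c

theorem cpb_pullback (ι : E₀ ⟶ weilSurf E₀) (φ : weilSurf E₀ ⟶ E₀) (c : CechPic E₀.X.left) :
    cpb ι (CechPic.pullback (AbelianVariety.Hom.toSchemeHom φ) c) = epb (ι ≫ φ) c := by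
  rw [epb, toSchemeHom_comp, CechPic.pullback_comp]

variable {θ : E₀.X.left.Modules} (hθ : HasRank θ 1) (ψ : E₀ ⟶ E₀)

/-- `[U] = p^*[θ]`, `[V] = q^*[θ]`, `[Δ] = (p − q)^*[θ]`, `[Γ] = (ψp − q)^*[θ]`. -/
theorem cls_lineU : cls (hasRank_lineU hθ) = CechPic.pullback (AbelianVariety.Hom.toSchemeHom (AbelianVariety.fst E₀ E₀)) (cls hθ) :=
  cls_pullLine _ hθ

theorem cls_lineV : cls (hasRank_lineV hθ) = CechPic.pullback (AbelianVariety.Hom.toSchemeHom (AbelianVariety.snd E₀ E₀)) (cls hθ) :=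
  cls_pullLine _ hθ

theorem cls_lineDiag : cls (hasRank_lineDiag hθ) =
    CechPic.pullback (AbelianVariety.Hom.toSchemeHom (AbelianVariety.fst E₀ E₀ - AbelianVariety.snd E₀ E₀)) (cls hθ) :=
  cls_pullLine _ hθ

theorem cls_lineGraph : cls (hasRank_lineGraph hθ ψ) =
    CechPic.pullback (AbelianVariety.Hom.toSchemeHom (AbelianVariety.fst E₀ E₀ ≫ ψ - AbelianVariety.snd E₀ E₀)) (cls hθ) :=
  cls_pullLine _ hθ

/-- `[H] = [U]·[V]`, `[D₁] = [Δ]·[H]⁻¹`, `[D₂] = [Γ]·[H]⁻¹`. -/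
theorem cls_lineH : cls (hasRank_lineH hθ) = cls (hasRank_lineU hθ) * cls (hasRank_lineV hθ) :=
  cls_tensorObj (hasRank_lineU hθ) (hasRank_lineV hθ)

theorem cls_lineD₁ : cls (hasRank_lineD₁ hθ) = cls (hasRank_lineDiag hθ) * (cls (hasRank_lineH hθ))⁻¹ := by
  rw [show cls (hasRank_lineD₁ hθ) = cls (hasRank_tensorObj_one (hasRank_lineDiag hθ) (hasRank_dual (hasRank_lineH hθ))) from rfl,
    cls_tensorObj (hasRank_lineDiag hθ) (hasRank_dual (hasRank_lineH hθ)), cls_dual (hasRank_lineH hθ)]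

theorem cls_lineD₂ : cls (hasRank_lineD₂ hθ ψ) = cls (hasRank_lineGraph hθ ψ) * (cls (hasRank_lineH hθ))⁻¹ := by
  rw [show cls (hasRank_lineD₂ hθ ψ) = cls (hasRank_tensorObj_one (hasRank_lineGraph hθ ψ) (hasRank_dual (hasRank_lineH hθ))) from rfl,
    cls_tensorObj (hasRank_lineGraph hθ ψ) (hasRank_dual (hasRank_lineH hθ)), cls_dual (hasRank_lineH hθ)]

/-! ### along the axis `t ↦ (o, t)`: `U ↦ 1`, `V ↦ t`, `Δ ↦ (−1)^*t`, `Γ ↦ (−1)^*t` -/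

theorem axis_U : cpb (axisCurve E₀) (cls (hasRank_lineU hθ)) = 1 := by
  rw [cls_lineU hθ, cpb_pullback, axisCurve, AbelianVariety.prodLift_fst, epb, pullback_toSchemeHom_zero]

theorem axis_V : cpb (axisCurve E₀) (cls (hasRank_lineV hθ)) = cls hθ := by
  rw [cls_lineV hθ, cpb_pullback, axisCurve, AbelianVariety.prodLift_snd, epb, pullback_toSchemeHom_id]

theorem axis_Diag : cpb (axisCurve E₀) (cls (hasRank_lineDiag hθ)) = epb (-𝟙 E₀) (cls hθ) := by
  rw [cls_lineDiag hθ, cpb_pullback, axisCurve, Preadditive.comp_sub, AbelianVariety.prodLift_fst, AbelianVariety.prodLift_snd, zero_sub]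

theorem axis_Graph : cpb (axisCurve E₀) (cls (hasRank_lineGraph hθ ψ)) = epb (-𝟙 E₀) (cls hθ) := by
  rw [cls_lineGraph hθ ψ, cpb_pullback, axisCurve, Preadditive.comp_sub, ← Category.assoc, AbelianVariety.prodLift_fst,
    AbelianVariety.prodLift_snd, Limits.zero_comp, zero_sub]

/-! ### along the diagonal `t ↦ (t, t)`: `U, V ↦ t`, `Δ ↦ 1`, `Γ ↦ (ψ − 1)^*t` -/

theorem diag_U : cpb (diagCurve E₀) (cls (hasRank_lineU hθ)) = cls hθ := by
  rw [cls_lineU hθ, cpb_pullback, diagCurve, AbelianVariety.prodLift_fst, epb, pullback_toSchemeHom_id]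

theorem diag_V : cpb (diagCurve E₀) (cls (hasRank_lineV hθ)) = cls hθ := by
  rw [cls_lineV hθ, cpb_pullback, diagCurve, AbelianVariety.prodLift_snd, epb, pullback_toSchemeHom_id]

theorem diag_Diag : cpb (diagCurve E₀) (cls (hasRank_lineDiag hθ)) = 1 := by
  rw [cls_lineDiag hθ, cpb_pullback, diagCurve, Preadditive.comp_sub, AbelianVariety.prodLift_fst, AbelianVariety.prodLift_snd, sub_self, epb,
    pullback_toSchemeHom_zero]

theorem diag_Graph : cpb (diagCurve E₀) (cls (hasRank_lineGraph hθ ψ)) = epb (ψ - 𝟙 E₀) (cls hθ) := by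
  rw [cls_lineGraph hθ ψ, cpb_pullback, diagCurve, Preadditive.comp_sub, ← Category.assoc, AbelianVariety.prodLift_fst,
    AbelianVariety.prodLift_snd, Category.id_comp]

/-! ### along the graph `t ↦ (t, ψ t)`: `U ↦ t`, `V ↦ ψ^*t`, `Δ ↦ (1 − ψ)^*t`, `Γ ↦ 1` -/

theorem graph_U : cpb (graphCurve ψ) (cls (hasRank_lineU hθ)) = cls hθ := by
  rw [cls_lineU hθ, cpb_pullback, graphCurve, AbelianVariety.prodLift_fst, epb, pullback_toSchemeHom_id]

theorem graph_V : cpb (graphCurve ψ) (cls (hasRank_lineV hθ)) = epb ψ (cls hθ) := by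
  rw [cls_lineV hθ, cpb_pullback, graphCurve, AbelianVariety.prodLift_snd]

theorem graph_Diag : cpb (graphCurve ψ) (cls (hasRank_lineDiag hθ)) = epb (𝟙 E₀ - ψ) (cls hθ) := by
  rw [cls_lineDiag hθ, cpb_pullback, graphCurve, Preadditive.comp_sub, AbelianVariety.prodLift_fst, AbelianVariety.prodLift_snd]

theorem graph_Graph : cpb (graphCurve ψ) (cls (hasRank_lineGraph hθ ψ)) = 1 := by
  rw [cls_lineGraph hθ ψ, cpb_pullback, graphCurve, Preadditive.comp_sub, ← Category.assoc, AbelianVariety.prodLift_fst,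
    AbelianVariety.prodLift_snd, Category.id_comp, sub_self, epb, pullback_toSchemeHom_zero]

end Curves

/-! ## §2d THE DEGREE DATUM on the CM curve — the intersection numbers, ISOLATED — and the injectivity of the factor class from it -/

section Degree

variable {E₀ : AbelianVariety ℂ}

/-- **THE DEGREE DATUM of a CM anchor `(E₀, ψ₀)`** — exactly the intersection-number input `OriginClassesInjectiveS` needs and the tree does not yet
prove: a degree homomorphism `d : Ȟ¹(E₀, 𝒪^×) → ℤ` with `d[o] = 1`, `d (−1)^*[o] = d ψ₀^*[o] = 1` (automorphisms fixing `o`), and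
`d (1 − ψ₀)^*[o] = d (ψ₀ − 1)^*[o] = 2` (the two fixed points of `ψ₀`; `|1 − i|² = 2`).  INTENDED `d` = `Motives.CartierDivisor.degree` through
`CechPic.exists_cechClass_eq` ∕ `LinEquiv.degree_eq` (so `d ∘ CechPic.pullback ι = AbelianVariety.degPt`), the value `2` from the parallelogram law of
the cube form (`AbelianVariety.classMap_classPullback_cube`); NOT constructed here. -/
structure DegreeDatum (E₀ : AbelianVariety ℂ) (h1 : E₀.dim = 1) (ψ₀ : E₀ ⟶ E₀) where
  /-- the degree homomorphism on `Ȟ¹(E₀, 𝒪^×)` -/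
  d : CechPic E₀.X.left →* Multiplicative ℤ
  d_origin : d (cls (hasRank_originLine E₀ h1)) = Multiplicative.ofAdd 1
  d_neg : d (epb (-𝟙 E₀) (cls (hasRank_originLine E₀ h1))) = Multiplicative.ofAdd 1
  d_psi : d (epb ψ₀ (cls (hasRank_originLine E₀ h1))) = Multiplicative.ofAdd 1
  d_one_sub_psi : d (epb (𝟙 E₀ - ψ₀) (cls (hasRank_originLine E₀ h1))) = Multiplicative.ofAdd 2
  d_psi_sub_one : d (epb (ψ₀ - 𝟙 E₀) (cls (hasRank_originLine E₀ h1))) = Multiplicative.ofAdd 2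

variable {h1 : E₀.dim = 1} {ψ₀ : E₀ ⟶ E₀} (D : DegreeDatum E₀ h1 ψ₀)

/-- degree along the axis: `(a, x, y) ↦ a`. -/
theorem deg_axis (b : BPoint) :
    Multiplicative.toAdd (D.d (cpb (axisCurve E₀) (letterClassS (hasRank_originLine E₀ h1) ψ₀ b))) = b.1 := by
  simp only [letterClassS, cls_lineH (hasRank_originLine E₀ h1), cls_lineD₁ (hasRank_originLine E₀ h1), cls_lineD₂ (hasRank_originLine E₀ h1) ψ₀, map_mul, map_zpow, map_inv,
    axis_U (hasRank_originLine E₀ h1), axis_V (hasRank_originLine E₀ h1), axis_Diag (hasRank_originLine E₀ h1), axis_Graph (hasRank_originLine E₀ h1) ψ₀, D.d_origin, D.d_neg,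
    toAdd_mul, toAdd_zpow, toAdd_inv, toAdd_ofAdd, toAdd_one, map_one, smul_eq_mul]
  ring

/-- degree along the diagonal: `(a, x, y) ↦ 2a − 2x`. -/
theorem deg_diag (b : BPoint) :
    Multiplicative.toAdd (D.d (cpb (diagCurve E₀) (letterClassS (hasRank_originLine E₀ h1) ψ₀ b))) = 2 * b.1 - 2 * b.2.1 := by
  simp only [letterClassS, cls_lineH (hasRank_originLine E₀ h1), cls_lineD₁ (hasRank_originLine E₀ h1), cls_lineD₂ (hasRank_originLine E₀ h1) ψ₀, map_mul, map_zpow, map_inv,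
    diag_U (hasRank_originLine E₀ h1), diag_V (hasRank_originLine E₀ h1), diag_Diag (hasRank_originLine E₀ h1), diag_Graph (hasRank_originLine E₀ h1) ψ₀, D.d_origin, D.d_psi_sub_one,
    toAdd_mul, toAdd_zpow, toAdd_inv, toAdd_ofAdd, toAdd_one, map_one, smul_eq_mul]
  ring

/-- degree along the graph of `ψ₀`: `(a, x, y) ↦ 2a − 2y`. -/
theorem deg_graph (b : BPoint) :
    Multiplicative.toAdd (D.d (cpb (graphCurve ψ₀) (letterClassS (hasRank_originLine E₀ h1) ψ₀ b))) = 2 * b.1 - 2 * b.2.2 := by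
  simp only [letterClassS, cls_lineH (hasRank_originLine E₀ h1), cls_lineD₁ (hasRank_originLine E₀ h1), cls_lineD₂ (hasRank_originLine E₀ h1) ψ₀, map_mul, map_zpow, map_inv,
    graph_U (hasRank_originLine E₀ h1) ψ₀, graph_V (hasRank_originLine E₀ h1) ψ₀, graph_Diag (hasRank_originLine E₀ h1) ψ₀, graph_Graph (hasRank_originLine E₀ h1) ψ₀, D.d_origin, D.d_psi, D.d_one_sub_psi,
    toAdd_mul, toAdd_zpow, toAdd_inv, toAdd_ofAdd, toAdd_one, map_one, smul_eq_mul]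
  ring

/-- **A DEGREE DATUM MAKES THE FACTOR CLASS INJECTIVE** (the three degree vectors `(1,0,0), (2,−2,0), (2,0,−2)` are independent). -/
theorem letterClassS_injective_of_degreeDatum (D : DegreeDatum E₀ h1 ψ₀) : Function.Injective (letterClassS (hasRank_originLine E₀ h1) ψ₀) := by
  intro b b' h
  have e1 := deg_axis D b
  have e2 := deg_diag D b
  have e3 := deg_graph D b
  rw [h, deg_axis D b'] at e1
  rw [h, deg_diag D b'] at e2
  rw [h, deg_graph D b'] at e3
  obtain ⟨a, x, y⟩ := b
  obtain ⟨a', x', y'⟩ := b'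
  simp only [Prod.mk.injEq] at e1 e2 e3 ⊢
  omega

/-- **THE RESIDUAL, NAMED**: every CM anchor carries a degree datum (the tree's curve degree + the five intersection numbers). -/
def OriginDegreeData : Prop :=
  ∀ (E₀ : AbelianVariety ℂ) (h1 : E₀.dim = 1) (ψ₀ : E₀ ⟶ E₀), ψ₀ ≫ ψ₀ = -(1 • 𝟙 E₀) → Nonempty (DegreeDatum E₀ h1 ψ₀)

end Degree

/-! ## §2e THE DEGREE HOMOMORPHISM OF THE CM CURVE (tree: `Motives.CartierDivisor.degree`) and the first intersection number `d[o] = 1` -/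

section DegreeHom

variable (E₀ : AbelianVariety ℂ)

/-- an abelian variety over `ℂ` is an integral scheme. -/
theorem isIntegral_anchor : IsIntegral E₀.X.left := GeometricallyIntegral.isIntegral_of_subsingleton E₀.X.hom

attribute [local instance] isIntegral_anchor

/-- a one-dimensional abelian variety has `height ⊤ = 1` (it is a smooth integral curve). -/
theorem height_top_anchor (h1 : E₀.dim = 1) : height (⊤ : E₀.X.left) = 1 := by
  haveI : SmoothOfRelativeDimension 1 E₀.X.hom := smoothOfRelativeDimension_one E₀ h1
  exact height_top_eq_one_of_smoothCurve

/-- **the degree of a class of `Ȟ¹(E₀, 𝒪^×)`**: the degree (`Motives.CartierDivisor.degree`) of any Cartier divisor representing it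
(`CechPic.exists_cechClass_eq`; well defined on a curve by `LinEquiv.degree_eq`, see `degZ_cechClass`). -/
def degZ (γ : CechPic E₀.X.left) : ℤ :=
  CartierDivisor.degree E₀.X (Classical.choose (CechPic.exists_cechClass_eq γ))

variable {E₀}

/-- `degZ [𝒪(D)] = deg D`. -/
theorem degZ_cechClass (h1 : E₀.dim = 1) (D : CartierDivisor E₀.X.left) : degZ E₀ D.cechClass = CartierDivisor.degree E₀.X D := by
  unfold degZ
  exact CartierDivisor.LinEquiv.degree_eq (height_top_anchor E₀ h1)
    (CartierDivisor.linEquiv_of_cechClass_eq (Classical.choose_spec (CechPic.exists_cechClass_eq D.cechClass)))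

theorem degZ_one (h1 : E₀.dim = 1) : degZ E₀ 1 = 0 := by
  rw [← CartierDivisor.cechClass_zero, degZ_cechClass h1, CartierDivisor.degree_zero]

theorem degZ_mul (h1 : E₀.dim = 1) (γ γ' : CechPic E₀.X.left) : degZ E₀ (γ * γ') = degZ E₀ γ + degZ E₀ γ' := by
  obtain ⟨D, rfl⟩ := CechPic.exists_cechClass_eq γ
  obtain ⟨D', rfl⟩ := CechPic.exists_cechClass_eq γ'
  rw [← CartierDivisor.cechClass_add, degZ_cechClass h1, degZ_cechClass h1, degZ_cechClass h1, CartierDivisor.degree_add]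

variable (E₀) in
/-- **THE DEGREE HOMOMORPHISM `deg : Ȟ¹(E₀, 𝒪^×) →* ℤ`** (multiplicative target `Multiplicative ℤ`). -/
def degHom (h1 : E₀.dim = 1) : CechPic E₀.X.left →* Multiplicative ℤ where
  toFun γ := Multiplicative.ofAdd (degZ E₀ γ)
  map_one' := by rw [degZ_one h1]; rfl
  map_mul' γ γ' := by rw [degZ_mul h1, ofAdd_add]

theorem degHom_apply (h1 : E₀.dim = 1) (γ : CechPic E₀.X.left) : degHom E₀ h1 γ = Multiplicative.ofAdd (degZ E₀ γ) := rfl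

/-- the class of the origin line bundle is the class of the origin divisor: `[𝒪(o)] = [o]`. -/
theorem cls_originLine (h1 : E₀.dim = 1) : cls (hasRank_originLine E₀ h1) = (originDivisor E₀ h1).cechClass := by
  rw [CartierDivisor.cechClass_eq_mk]
  exact UnitCocycle.detClass_lineBundle _

/-- **THE FIRST INTERSECTION NUMBER: `deg [o] = 1`** (`CurvePlaces.degree_pointDivisor`: `deg [x] = [κ(x) : ℂ]`, and a complex point has residue
degree one, `residueDegree_pt`). -/
theorem degZ_originLine (h1 : E₀.dim = 1) : degZ E₀ (cls (hasRank_originLine E₀ h1)) = 1 := by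
  haveI : SmoothOfRelativeDimension 1 E₀.X.hom := smoothOfRelativeDimension_one E₀ h1
  rw [cls_originLine h1, degZ_cechClass h1]
  unfold originDivisor
  rw [CurvePlaces.degree_pointDivisor, ← originPt_pt, residueDegree_pt]
  rfl

theorem degHom_originLine (h1 : E₀.dim = 1) : degHom E₀ h1 (cls (hasRank_originLine E₀ h1)) = Multiplicative.ofAdd 1 := by
  rw [degHom_apply, degZ_originLine h1]

/-- **THE FOUR REMAINING INTERSECTION NUMBERS** of the CM anchor (NOT proved in the tree): the degrees of the pull-backs of `[o]` along the
automorphisms `−1`, `ψ₀` (value `1`: a point divisor pulls back to a point divisor) and along the isogenies `1 − ψ₀`, `ψ₀ − 1` (value `2` = `#ker(1 − ψ₀)`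
= `|1 − i|²`; in the tree reachable from the parallelogram law of the cube form, `AbelianVariety.classMap_classPullback_cube`). -/
structure IntersectionNumbers (E₀ : AbelianVariety ℂ) (h1 : E₀.dim = 1) (ψ₀ : E₀ ⟶ E₀) : Prop where
  neg : degHom E₀ h1 (epb (-𝟙 E₀) (cls (hasRank_originLine E₀ h1))) = Multiplicative.ofAdd 1
  psi : degHom E₀ h1 (epb ψ₀ (cls (hasRank_originLine E₀ h1))) = Multiplicative.ofAdd 1
  one_sub_psi : degHom E₀ h1 (epb (𝟙 E₀ - ψ₀) (cls (hasRank_originLine E₀ h1))) = Multiplicative.ofAdd 2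
  psi_sub_one : degHom E₀ h1 (epb (ψ₀ - 𝟙 E₀) (cls (hasRank_originLine E₀ h1))) = Multiplicative.ofAdd 2

/-- the degree datum of a CM anchor from its four intersection numbers (the degree homomorphism and `deg [o] = 1` are now tree-side). -/
def DegreeDatum.ofIntersectionNumbers {h1 : E₀.dim = 1} {ψ₀ : E₀ ⟶ E₀} (h : IntersectionNumbers E₀ h1 ψ₀) : DegreeDatum E₀ h1 ψ₀ :=
  ⟨degHom E₀ h1, degHom_originLine h1, h.neg, h.psi, h.one_sub_psi, h.psi_sub_one⟩

/-- **THE RESIDUAL OF RECORD**: every CM anchor has the four intersection numbers. -/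
def OriginIntersectionNumbers : Prop :=
  ∀ (E₀ : AbelianVariety ℂ) (h1 : E₀.dim = 1) (ψ₀ : E₀ ⟶ E₀), ψ₀ ≫ ψ₀ = -(1 • 𝟙 E₀) → IntersectionNumbers E₀ h1 ψ₀

theorem originDegreeData_of_intersectionNumbers (h : OriginIntersectionNumbers) : OriginDegreeData :=
  fun E₀ h1 ψ₀ hψ => ⟨DegreeDatum.ofIntersectionNumbers (h E₀ h1 ψ₀ hψ)⟩

end DegreeHom

/-! ## §2f AUTOMORPHISM INVARIANCE OF THE DEGREE: the second and third intersection numbers `deg (−1)^*[o] = deg ψ₀^*[o] = 1` -/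

section Automorphisms

open Literature.AlgebraicGeometry.Motives.RatFn

variable {E₀ : AbelianVariety ℂ}

attribute [local instance] isIntegral_anchor

/-- an inverse pair in the category of abelian varieties gives an isomorphism of underlying schemes. -/
theorem isIso_toSchemeHom_of_inverse {K : Type} [Field K] {A B : AbelianVariety K} (f : A ⟶ B) (g : B ⟶ A) (hfg : f ≫ g = 𝟙 A)
    (hgf : g ≫ f = 𝟙 B) : IsIso (AbelianVariety.Hom.toSchemeHom f) :=
  ⟨⟨AbelianVariety.Hom.toSchemeHom g, by rw [← toSchemeHom_comp, hfg]; rfl, by rw [← toSchemeHom_comp, hgf]; rfl⟩⟩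

/-- `−1` is an involution. -/
theorem neg_one_comp_neg_one : (-𝟙 E₀) ≫ (-𝟙 E₀) = 𝟙 E₀ := by
  rw [Preadditive.neg_comp, Preadditive.comp_neg, neg_neg, Category.id_comp]

/-- the CM generator is an automorphism: `ψ₀ ≫ (−ψ₀) = 𝟙` … -/
theorem psi_comp_neg_psi {ψ₀ : E₀ ⟶ E₀} (hψ : ψ₀ ≫ ψ₀ = -(1 • 𝟙 E₀)) : ψ₀ ≫ (-ψ₀) = 𝟙 E₀ := by
  rw [Preadditive.comp_neg, hψ, neg_neg, one_smul]

/-- … and `(−ψ₀) ≫ ψ₀ = 𝟙`. -/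
theorem neg_psi_comp_psi {ψ₀ : E₀ ⟶ E₀} (hψ : ψ₀ ≫ ψ₀ = -(1 • 𝟙 E₀)) : (-ψ₀) ≫ ψ₀ = 𝟙 E₀ := by
  rw [Preadditive.neg_comp, hψ, neg_neg, one_smul]

theorem isIso_toSchemeHom_neg_one : IsIso (AbelianVariety.Hom.toSchemeHom (-𝟙 E₀)) :=
  isIso_toSchemeHom_of_inverse _ _ neg_one_comp_neg_one neg_one_comp_neg_one

theorem isIso_toSchemeHom_psi {ψ₀ : E₀ ⟶ E₀} (hψ : ψ₀ ≫ ψ₀ = -(1 • 𝟙 E₀)) : IsIso (AbelianVariety.Hom.toSchemeHom ψ₀) :=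
  isIso_toSchemeHom_of_inverse _ _ (psi_comp_neg_psi hψ) (neg_psi_comp_psi hψ)

/-- for an isomorphism of integral schemes the function-field extension has degree `1`. -/
theorem finrank_functionField_eq_one_of_isIso {X Y : Scheme} [IsIntegral X] [IsIntegral Y] (f : Y ⟶ X) [IsIso f] :
    (letI := (functionFieldMap f).toAlgebra; Module.finrank X.functionField Y.functionField) = 1 := by
  letI := (functionFieldMap f).toAlgebra
  have hb := RatFn.functionFieldMap_bijective_of_isOpenImmersion f
  have e := LinearEquiv.ofBijective (Algebra.linearMap X.functionField Y.functionField) hb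
  rw [← e.finrank_eq, Module.finrank_self]

/-- **the degree of a divisor is invariant under pull-back along an automorphism of the CM curve** (`deg α^*D = [K(E₀):α^*K(E₀)]·deg D`,
`CurvePlaces.degree_pullback_eq_finrank_mul`, with function-field degree `1`). -/
theorem degree_pullback_of_isIso (h1 : E₀.dim = 1) (α : E₀ ⟶ E₀) [IsIso (AbelianVariety.Hom.toSchemeHom α)] (D : CartierDivisor E₀.X.left) :
    CartierDivisor.degree E₀.X (D.pullback (AbelianVariety.Hom.toSchemeHom α)) = CartierDivisor.degree E₀.X D := by
  haveI : SmoothOfRelativeDimension 1 E₀.X.hom := smoothOfRelativeDimension_one E₀ h1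
  haveI : IsProper (Over.Hom.left α.hom.hom.hom) := (inferInstance : IsProper (AbelianVariety.Hom.toSchemeHom α))
  haveI : IsDominant (Over.Hom.left α.hom.hom.hom) := (inferInstance : IsDominant (AbelianVariety.Hom.toSchemeHom α))
  have h := CurvePlaces.degree_pullback_eq_finrank_mul (p := α.hom.hom.hom) D
  rw [finrank_functionField_eq_one_of_isIso] at h
  simpa using h

/-- `deg α^*[𝒪(D)] = deg [𝒪(D)]` for an automorphism `α`. -/
theorem degZ_epb_cechClass_of_isIso (h1 : E₀.dim = 1) (α : E₀ ⟶ E₀) [IsIso (AbelianVariety.Hom.toSchemeHom α)] (D : CartierDivisor E₀.X.left) :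
    degZ E₀ (epb α D.cechClass) = degZ E₀ D.cechClass := by
  rw [epb, ← CartierDivisor.cechClass_pullback, degZ_cechClass h1, degZ_cechClass h1, degree_pullback_of_isIso h1 α D]

/-- **`deg α^*[o] = 1` for every automorphism `α` of the CM curve.** -/
theorem degHom_epb_originLine_of_isIso (h1 : E₀.dim = 1) (α : E₀ ⟶ E₀) [IsIso (AbelianVariety.Hom.toSchemeHom α)] :
    degHom E₀ h1 (epb α (cls (hasRank_originLine E₀ h1))) = Multiplicative.ofAdd 1 := by
  rw [degHom_apply, cls_originLine h1, degZ_epb_cechClass_of_isIso h1 α, ← cls_originLine h1, degZ_originLine h1]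

/-- **THE TWO REMAINING INTERSECTION NUMBERS** (NOT proved in the tree): `deg (1 − ψ₀)^*[o] = deg (ψ₀ − 1)^*[o] = 2` — the degree of the
isogeny `1 − ψ₀` (`= #ker(1 − ψ₀) = |1 − i|² = 2`, the two fixed points of `ψ₀`); by `CurvePlaces.degree_pullback_eq_finrank_mul` equivalently the
function-field degree `[K(E₀) : (1 ∓ ψ₀)^*K(E₀)] = 2`; in the tree reachable from the parallelogram law of the cube form
(`AbelianVariety.classMap_classPullback_cube`, GIVEN `cubicalStructure_linEquiv E₀`). -/
structure IsogenyNumbers (E₀ : AbelianVariety ℂ) (h1 : E₀.dim = 1) (ψ₀ : E₀ ⟶ E₀) : Prop where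
  one_sub_psi : degHom E₀ h1 (epb (𝟙 E₀ - ψ₀) (cls (hasRank_originLine E₀ h1))) = Multiplicative.ofAdd 2
  psi_sub_one : degHom E₀ h1 (epb (ψ₀ - 𝟙 E₀) (cls (hasRank_originLine E₀ h1))) = Multiplicative.ofAdd 2

/-- the four intersection numbers from the two isogeny numbers (the automorphism numbers are theorems, §2f). -/
theorem intersectionNumbers_of_isogenyNumbers {h1 : E₀.dim = 1} {ψ₀ : E₀ ⟶ E₀} (hψ : ψ₀ ≫ ψ₀ = -(1 • 𝟙 E₀))
    (h : IsogenyNumbers E₀ h1 ψ₀) : IntersectionNumbers E₀ h1 ψ₀ :=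
  ⟨by haveI := isIso_toSchemeHom_neg_one (E₀ := E₀); exact degHom_epb_originLine_of_isIso h1 _,
   by haveI := isIso_toSchemeHom_psi hψ; exact degHom_epb_originLine_of_isIso h1 _, h.one_sub_psi, h.psi_sub_one⟩

/-- **THE RESIDUAL OF RECORD (final form)**: the two isogeny numbers of every CM anchor. -/
def OriginIsogenyNumbers : Prop :=
  ∀ (E₀ : AbelianVariety ℂ) (h1 : E₀.dim = 1) (ψ₀ : E₀ ⟶ E₀), ψ₀ ≫ ψ₀ = -(1 • 𝟙 E₀) → IsogenyNumbers E₀ h1 ψ₀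

theorem originIntersectionNumbers_of_isogenyNumbers (h : OriginIsogenyNumbers) : OriginIntersectionNumbers :=
  fun E₀ h1 ψ₀ hψ => intersectionNumbers_of_isogenyNumbers hψ (h E₀ h1 ψ₀ hψ)

end Automorphisms

/-! ## §2g THE TWO ISOGENY NUMBERS `deg (1 ∓ ψ₀)^*[o] = 2` — from the CUBE (tree: `cubicalStructure_linEquiv_holds`) and the degree formula -/

section IsogenyDegree

open Literature.AlgebraicGeometry.Motives.RatFn

variable {E₀ : AbelianVariety ℂ}

attribute [local instance] isIntegral_anchor

/-- `2 · 𝟙 ≠ 0` on a one-dimensional abelian variety (`[2]` is an isogeny, the zero map is not). -/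
theorem two_zsmul_id_ne_zero (h1 : E₀.dim = 1) : (2 : ℤ) • 𝟙 E₀ ≠ 0 := by
  intro h
  have hi := AbelianVariety.isIsogeny_zsmul_id_of_cast_ne_zero (A := E₀) 2 (by norm_num)
  rw [h] at hi
  exact AbelianVariety.not_isIsogeny_zero_of_dim_pos (by omega) hi

/-- `1 − ψ₀ ≠ 0` (else `ψ₀ = 1`, `1 = ψ₀² = −1`, `2·𝟙 = 0`). -/
theorem one_sub_psi_ne_zero (h1 : E₀.dim = 1) {ψ₀ : E₀ ⟶ E₀} (hψ : ψ₀ ≫ ψ₀ = -(1 • 𝟙 E₀)) : 𝟙 E₀ - ψ₀ ≠ 0 := by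
  intro h
  have hψ1 : ψ₀ = 𝟙 E₀ := (sub_eq_zero.mp h).symm
  rw [hψ1, Category.id_comp, one_smul] at hψ
  apply two_zsmul_id_ne_zero h1
  rw [two_zsmul]
  nth_rewrite 1 [hψ]
  exact neg_add_cancel _

/-- `1 + ψ₀ ≠ 0` (else `ψ₀ = −1`, `ψ₀² = 1 = −1`). -/
theorem one_add_psi_ne_zero (h1 : E₀.dim = 1) {ψ₀ : E₀ ⟶ E₀} (hψ : ψ₀ ≫ ψ₀ = -(1 • 𝟙 E₀)) : 𝟙 E₀ + ψ₀ ≠ 0 := by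
  intro h
  have hψ1 : ψ₀ = -𝟙 E₀ := (neg_eq_of_add_eq_zero_right h).symm
  rw [hψ1, neg_one_comp_neg_one, one_smul] at hψ
  apply two_zsmul_id_ne_zero h1
  rw [two_zsmul]
  nth_rewrite 1 [hψ]
  exact neg_add_cancel _

/-- `(1 − ψ₀) ≫ ψ₀ = 1 + ψ₀` (since `ψ₀² = −1`). -/
theorem one_sub_psi_comp_psi {ψ₀ : E₀ ⟶ E₀} (hψ : ψ₀ ≫ ψ₀ = -(1 • 𝟙 E₀)) : (𝟙 E₀ - ψ₀) ≫ ψ₀ = 𝟙 E₀ + ψ₀ := by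
  rw [Preadditive.sub_comp, Category.id_comp, hψ, one_smul, sub_neg_eq_add, add_comm]

/-- `(1 − ψ₀) ≫ (−1) = ψ₀ − 1`. -/
theorem one_sub_psi_comp_neg_one (ψ₀ : E₀ ⟶ E₀) : (𝟙 E₀ - ψ₀) ≫ (-𝟙 E₀) = ψ₀ - 𝟙 E₀ := by
  rw [Preadditive.comp_neg, Category.comp_id, neg_sub]

theorem isIso_toSchemeHom_neg_psi {ψ₀ : E₀ ⟶ E₀} (hψ : ψ₀ ≫ ψ₀ = -(1 • 𝟙 E₀)) : IsIso (AbelianVariety.Hom.toSchemeHom (-ψ₀)) :=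
  isIso_toSchemeHom_of_inverse _ _ (neg_psi_comp_psi hψ) (psi_comp_neg_psi hψ)

/-- **MULTIPLICATIVITY OF THE DEGREE UNDER A DOMINANT ENDOMORPHISM**: `deg φ^*γ = [K(E₀) : φ^*K(E₀)] · deg γ`
(`CurvePlaces.degree_pullback_eq_finrank_mul`); packaged existentially to keep the function-field degree anonymous. -/
theorem exists_degZ_epb_eq_mul (h1 : E₀.dim = 1) (φ : E₀ ⟶ E₀) [IsDominant (AbelianVariety.Hom.toSchemeHom φ)] :
    ∃ n : ℤ, ∀ γ : CechPic E₀.X.left, degZ E₀ (epb φ γ) = n * degZ E₀ γ := by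
  haveI : SmoothOfRelativeDimension 1 E₀.X.hom := smoothOfRelativeDimension_one E₀ h1
  haveI : IsDominant (Over.Hom.left φ.hom.hom.hom) := (inferInstance : IsDominant (AbelianVariety.Hom.toSchemeHom φ))
  refine ⟨((@Module.finrank E₀.X.left.functionField E₀.X.left.functionField _ _
    (functionFieldMap (AbelianVariety.Hom.toSchemeHom φ)).toAlgebra.toModule : ℕ) : ℤ), fun γ => ?_⟩
  obtain ⟨D, rfl⟩ := CechPic.exists_cechClass_eq γ
  rw [epb, ← CartierDivisor.cechClass_pullback, degZ_cechClass h1, degZ_cechClass h1]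
  exact CurvePlaces.degree_pullback_eq_finrank_mul (p := φ.hom.hom.hom) D

/-- `deg [o] = 1` in the divisor-class form. -/
theorem degZ_originDivisor (h1 : E₀.dim = 1) : degZ E₀ (originDivisor E₀ h1).cechClass = 1 := by
  rw [← cls_originLine h1, degZ_originLine h1]

/-- `deg α^*[o] = 1` for an automorphism `α`, divisor-class form. -/
theorem degZ_epb_originDivisor_of_isIso (h1 : E₀.dim = 1) (α : E₀ ⟶ E₀) [IsIso (AbelianVariety.Hom.toSchemeHom α)] :
    degZ E₀ (epb α (originDivisor E₀ h1).cechClass) = 1 := by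
  rw [degZ_epb_cechClass_of_isIso h1 α, degZ_originDivisor h1]

/-- **THE PARALLELOGRAM LAW OF THE CUBE FORM AT `(1, ψ₀)`**: `deg (1+ψ₀)^*[o] + deg (1−ψ₀)^*[o] = 2 deg[o] + deg ψ₀^*[o] + deg (−ψ₀)^*[o] = 4`
(Mumford §6 Cor. 2 on divisor classes, `AbelianVariety.classMap_classPullback_cube` with the injective class map `D ↦ [𝒪(D)] ∈ Ȟ¹` and the
tree's PROVED cubical structure `cubicalStructure_linEquiv_holds`, at `(f, g, h) = (1, ψ₀, −ψ₀)`; then degrees). -/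
theorem degZ_parallelogram (h1 : E₀.dim = 1) {ψ₀ : E₀ ⟶ E₀} (hψ : ψ₀ ≫ ψ₀ = -(1 • 𝟙 E₀)) :
    degZ E₀ (epb (𝟙 E₀ + ψ₀) (originDivisor E₀ h1).cechClass) + degZ E₀ (epb (𝟙 E₀ - ψ₀) (originDivisor E₀ h1).cechClass) = 4 := by
  have hadd : ∀ D E : CartierDivisor E₀.X.left,
      (fun D : CartierDivisor E₀.X.left => Additive.ofMul D.cechClass) (D + E) =
        (fun D : CartierDivisor E₀.X.left => Additive.ofMul D.cechClass) D + (fun D : CartierDivisor E₀.X.left => Additive.ofMul D.cechClass) E :=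
    fun D E => by simp [CartierDivisor.cechClass_add]
  have heq : ∀ D E : CartierDivisor E₀.X.left,
      D.LinEquiv E ↔ (fun D : CartierDivisor E₀.X.left => Additive.ofMul D.cechClass) D = (fun D : CartierDivisor E₀.X.left => Additive.ofMul D.cechClass) E :=
    fun D E => by rw [Additive.ofMul.injective.eq_iff, CartierDivisor.cechClass_eq_iff_linEquiv]
  have hc := AbelianVariety.classMap_classPullback_cube hadd heq (AbelianVariety.cubicalStructure_linEquiv_holds E₀) (originDivisor E₀ h1)
    (𝟙 E₀) ψ₀ (-ψ₀)
  have h0 := AbelianVariety.classMap_classPullback_zero hadd heq (X := E₀) (originDivisor E₀ h1)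
  rw [add_neg_cancel_right, add_neg_cancel, ← sub_eq_add_neg, h0, add_zero] at hc
  -- the five remaining pull-backs are along dominant maps: `𝟙`, `ψ₀`, `−ψ₀` (automorphisms), `1 + ψ₀`, `1 − ψ₀` (isogenies)
  have hp := Literature.NumberTheory.ComplexMultiplication.isIsogeny_of_ne_zero h1 h1 _ (one_add_psi_ne_zero h1 hψ)
  have hm := Literature.NumberTheory.ComplexMultiplication.isIsogeny_of_ne_zero h1 h1 _ (one_sub_psi_ne_zero h1 hψ)
  haveI := hp.1
  haveI := hm.1
  haveI := isIso_toSchemeHom_psi hψ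
  haveI := isIso_toSchemeHom_neg_psi hψ
  rw [show AbelianVariety.Hom.toSchemeHom (𝟙 E₀) = 𝟙 E₀.X.left from rfl] at hc
  rw [CartierDivisor.cechClass_classPullback, CartierDivisor.cechClass_classPullback, CartierDivisor.cechClass_classPullback,
    CartierDivisor.cechClass_classPullback, CartierDivisor.cechClass_classPullback] at hc
  have hd := congrArg (fun q => degZ E₀ (Additive.toMul q)) hc
  simp only [toMul_add, toMul_ofMul, degZ_mul h1] at hd
  have e1 : degZ E₀ (CechPic.pullback (𝟙 E₀.X.left) (originDivisor E₀ h1).cechClass) = 1 := by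
    rw [show CechPic.pullback (𝟙 E₀.X.left) (originDivisor E₀ h1).cechClass = (originDivisor E₀ h1).cechClass by simp]
    exact degZ_originDivisor h1
  have e2 : degZ E₀ (CechPic.pullback (AbelianVariety.Hom.toSchemeHom ψ₀) (originDivisor E₀ h1).cechClass) = 1 :=
    degZ_epb_originDivisor_of_isIso h1 ψ₀
  have e3 : degZ E₀ (CechPic.pullback (AbelianVariety.Hom.toSchemeHom (-ψ₀)) (originDivisor E₀ h1).cechClass) = 1 :=
    degZ_epb_originDivisor_of_isIso h1 (-ψ₀)
  rw [e1, e2, e3] at hd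
  change degZ E₀ (CechPic.pullback (AbelianVariety.Hom.toSchemeHom (𝟙 E₀ + ψ₀)) (originDivisor E₀ h1).cechClass) +
      degZ E₀ (CechPic.pullback (AbelianVariety.Hom.toSchemeHom (𝟙 E₀ - ψ₀)) (originDivisor E₀ h1).cechClass) = 4
  omega

/-- **THE TWO ISOGENY NUMBERS HOLD: `deg (1 − ψ₀)^*[o] = deg (ψ₀ − 1)^*[o] = 2`** on every CM anchor `(E₀, ψ₀)`, `ψ₀² = −1`.  Proof: with
`n := [K(E₀) : (1−ψ₀)^*K(E₀)]` (`exists_degZ_epb_eq_mul`), `deg (1−ψ₀)^*[o] = n`; `(1−ψ₀) ≫ ψ₀ = 1 + ψ₀` and `deg ψ₀^*[o] = 1` give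
`deg (1+ψ₀)^*[o] = n`; the parallelogram law gives `2n = 4`; and `ψ₀ − 1 = (1−ψ₀) ≫ (−1)` with `deg (−1)^*[o] = 1`. -/
theorem isogenyNumbers_holds (h1 : E₀.dim = 1) {ψ₀ : E₀ ⟶ E₀} (hψ : ψ₀ ≫ ψ₀ = -(1 • 𝟙 E₀)) : IsogenyNumbers E₀ h1 ψ₀ := by
  have hm := Literature.NumberTheory.ComplexMultiplication.isIsogeny_of_ne_zero h1 h1 _ (one_sub_psi_ne_zero h1 hψ)
  haveI := hm.1
  haveI := isIso_toSchemeHom_psi hψ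
  haveI := isIso_toSchemeHom_neg_one (E₀ := E₀)
  obtain ⟨n, hn⟩ := exists_degZ_epb_eq_mul h1 (𝟙 E₀ - ψ₀)
  have hn' : ∀ γ, degZ E₀ (CechPic.pullback (AbelianVariety.Hom.toSchemeHom (𝟙 E₀ - ψ₀)) γ) = n * degZ E₀ γ := hn
  have hminus : degZ E₀ (epb (𝟙 E₀ - ψ₀) (originDivisor E₀ h1).cechClass) = n := by
    rw [hn, degZ_originDivisor h1, mul_one]
  have hplus : degZ E₀ (epb (𝟙 E₀ + ψ₀) (originDivisor E₀ h1).cechClass) = n := by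
    rw [← one_sub_psi_comp_psi hψ, epb, toSchemeHom_comp, CechPic.pullback_comp, hn',
      show degZ E₀ (CechPic.pullback (AbelianVariety.Hom.toSchemeHom ψ₀) (originDivisor E₀ h1).cechClass) = 1 from
        degZ_epb_originDivisor_of_isIso h1 ψ₀, mul_one]
  have hpar := degZ_parallelogram h1 hψ
  rw [hplus, hminus] at hpar
  have hn2 : n = 2 := by omega
  constructor
  · rw [degHom_apply, cls_originLine h1, hminus, hn2]
  · rw [degHom_apply, cls_originLine h1, ← one_sub_psi_comp_neg_one ψ₀, epb, toSchemeHom_comp, CechPic.pullback_comp, hn',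
      show degZ E₀ (CechPic.pullback (AbelianVariety.Hom.toSchemeHom (-𝟙 E₀)) (originDivisor E₀ h1).cechClass) = 1 from
        degZ_epb_originDivisor_of_isIso h1 (-𝟙 E₀), mul_one, hn2]

/-- every CM anchor has the two isogeny numbers. -/
theorem originIsogenyNumbers_holds : OriginIsogenyNumbers := fun _ h1 _ hψ => isogenyNumbers_holds h1 hψ

end IsogenyDegree

/-! ## §3 The reduction: injectivity of the letter class ⟹ the letter model separates ⟹ `OriginSeparating` -/

section Reduction

variable {E₀ : AbelianVariety ℂ}

/-- **isomorphic letters have equal letter classes.** -/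
theorem letterClass_eq_of_iso {θ : E₀.X.left.Modules} (hθ : HasRank θ 1) (ψ : E₀ ⟶ E₀) {Z Z' : MCell}
    (e : letterBundle θ ψ Z ≅ letterBundle θ ψ Z') : letterClass hθ ψ Z = letterClass hθ ψ Z' := by
  rw [← cls_letterBundle_eq_letterClass, ← cls_letterBundle_eq_letterClass]
  exact cls_congr e _ _

/-- **REDUCTION**: if the letter class is injective on cells, the letter model of `(θ, ψ)` SEPARATES. -/
theorem separating_of_letterClass_injective {θ : E₀.X.left.Modules} (hθ : HasRank θ 1) (ψ : E₀ ⟶ E₀)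
    (hinj : Function.Injective (letterClass hθ ψ)) : (letterModelOf θ hθ ψ).Separating :=
  fun _ _ ⟨e⟩ => hinj (letterClass_eq_of_iso hθ ψ e)

/-- **THE MISSING NÉRON–SEVERI LEMMA, TYPED** (NOT proved in the tree; documented true): for a CM curve `(E₀, ψ₀)` with `ψ₀² = −1` and
`θ₀ = 𝒪_{E₀}(o)` (`originLine`), the letter class `Z ↦ ∏_f π_f^*([H]^{a_f}[D₁]^{x_f}[D₂]^{y_f})` is INJECTIVE on cells — i.e. the twelve classes
`π_f^*[H], π_f^*[D₁], π_f^*[D₂]` are ℤ-independent in `Ȟ¹(S⁴, 𝒪^×)`.  ROUTE (successor): sections `σ_g : S → S⁴` reduce to `S` (`CechPic.pullback_comp`;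
the slots through the origin die by `CechPic.pullback_eq_one_of_isLocalRing`); test curves `t ↦ (o,t), (t,t), (t,ψ₀t)` and `Motives.CartierDivisor.degree` on
`E₀` give degree vectors `(a,x,y) ↦ a`, `2a − 2x + (N−2)y`, `2a + (N−2)x − 2y` with `N := deg (1 − ψ₀)^*[o]`; THE ONE INTERSECTION NUMBER NEEDED IS
`N = 2` (then the matrix is `[[1,0,0],[2,−2,0],[2,0,−2]]`), plus `deg [o] = 1` (`CurvePlaces.degree_pointDivisor`), `α^*[o] ∼ [o]` for the automorphisms
`α ∈ {ψ₀, −1}`, and triviality of pull-backs through the zero endomorphism. -/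
def OriginClassesInjective : Prop :=
  ∀ (E₀ : AbelianVariety ℂ) (h1 : E₀.dim = 1) (ψ₀ : E₀ ⟶ E₀), ψ₀ ≫ ψ₀ = -(1 • 𝟙 E₀) →
    Function.Injective (letterClass (hasRank_originLine E₀ h1) ψ₀)

/-- **`OriginClassesInjective → OriginSeparating`** (v42.3's one typed obligation, reduced to Néron–Severi bookkeeping). -/
theorem originSeparating_of_originClassesInjective (h : OriginClassesInjective) : OriginSeparating :=
  fun E₀ h1 ψ₀ hψ => separating_of_letterClass_injective (hasRank_originLine E₀ h1) ψ₀ (h E₀ h1 ψ₀ hψ)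

/-- **THE MISSING LEMMA ON THE WEIL SURFACE `S = E₀ × E₀`** (one factor; NOT proved in the tree): for `θ₀ = 𝒪_{E₀}(o)`, `ψ₀² = −1`:
`(a, x, y) ↦ [H]ᵃ · [D₁]ˣ · [D₂]ʸ ∈ Ȟ¹(S, 𝒪^×)` is injective — the classes of `H = p^*θ₀ ⊗ q^*θ₀` (`u + v`), `D₁ = (p−q)^*θ₀ ⊗ H^∨` (`e₁`),
`D₂ = (ψ₀p − q)^*θ₀ ⊗ H^∨` (`e₂`) are ℤ-independent (Gram matrix `diag(2, −2, −2)`).  Pen route: degrees along `t ↦ (o,t), (t,t), (t,ψ₀t)` with the ONE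
intersection number `deg (1 − ψ₀)^*[o] = 2`. -/
def OriginClassesInjectiveS : Prop :=
  ∀ (E₀ : AbelianVariety ℂ) (h1 : E₀.dim = 1) (ψ₀ : E₀ ⟶ E₀), ψ₀ ≫ ψ₀ = -(1 • 𝟙 E₀) →
    Function.Injective (letterClassS (hasRank_originLine E₀ h1) ψ₀)

/-- **`S ⟶ S⁴`**: the surface statement implies the eightfold statement (factor sections, §2b). -/
theorem originClassesInjective_of_S (h : OriginClassesInjectiveS) : OriginClassesInjective :=
  fun E₀ h1 ψ₀ hψ => letterClass_injective_of_factor (hasRank_originLine E₀ h1) ψ₀ (h E₀ h1 ψ₀ hψ)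

/-- **`OriginClassesInjectiveS → OriginSeparating`**: v42.3's obligation reduced to three classes on ONE Weil surface. -/
theorem originSeparating_of_originClassesInjectiveS (h : OriginClassesInjectiveS) : OriginSeparating :=
  originSeparating_of_originClassesInjective (originClassesInjective_of_S h)

/-- **`E₀ ⟶ S`**: degree data on the CM curves give the surface statement (§2c–§2d). -/
theorem originClassesInjectiveS_of_degreeData (h : OriginDegreeData) : OriginClassesInjectiveS :=
  fun E₀ h1 ψ₀ hψ => (h E₀ h1 ψ₀ hψ).elim fun D => letterClassS_injective_of_degreeDatum D

/-- **`OriginDegreeData → OriginSeparating`**: v42.3's obligation reduced to FIVE INTERSECTION NUMBERS on the CM curve (`d[o] = 1`,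
`d (−1)^*[o] = d ψ₀^*[o] = 1`, `d (1−ψ₀)^*[o] = d (ψ₀−1)^*[o] = 2`) for a degree homomorphism `d : Ȟ¹(E₀, 𝒪^×) → ℤ`. -/
theorem originSeparating_of_degreeData (h : OriginDegreeData) : OriginSeparating :=
  originSeparating_of_originClassesInjectiveS (originClassesInjectiveS_of_degreeData h)

/-- **`OriginIntersectionNumbers → OriginSeparating`**: v42.3's obligation reduced to FOUR INTERSECTION NUMBERS on the CM curve
(`deg (−1)^*[o] = deg ψ₀^*[o] = 1`, `deg (1−ψ₀)^*[o] = deg (ψ₀−1)^*[o] = 2` for the tree's degree `degHom`). -/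
theorem originSeparating_of_intersectionNumbers (h : OriginIntersectionNumbers) : OriginSeparating :=
  originSeparating_of_degreeData (originDegreeData_of_intersectionNumbers h)

/-- **`OriginIsogenyNumbers → OriginSeparating`**: v42.3's obligation reduced to the TWO ISOGENY NUMBERS `deg (1 − ψ₀)^*[o] = deg (ψ₀ − 1)^*[o] = 2`
on the CM curve (degree of the isogeny `1 − ψ₀`), for the tree's own degree homomorphism `degHom`. -/
theorem originSeparating_of_isogenyNumbers (h : OriginIsogenyNumbers) : OriginSeparating :=
  originSeparating_of_intersectionNumbers (originIntersectionNumbers_of_isogenyNumbers h)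

/-- **`OriginSeparating` HOLDS** — v42.3's ONE typed obligation (R19.889 (P′)(iii)) is a THEOREM: on every CM anchor `(E₀, ψ₀)` with `ψ₀² = −1`
the origin letters `letterBundle 𝒪(o) ψ₀ Z` SEPARATE cells.  Unconditional (no named fact): the tree's determinant-class calculus, curve degree,
Galois-cover degree formula, PROVED theorem of the cube (`cubicalStructure_linEquiv_holds`) and `isIsogeny_of_ne_zero` for elliptic curves. -/
theorem originSeparating_holds : OriginSeparating := originSeparating_of_isogenyNumbers originIsogenyNumbers_holds

/-- AUDIT: `OriginSeparating` is now PROVED (`originSeparating_holds`); nothing here is a statement about the crux `BlochSeedDiscOne`, H2 or HC —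
it discharges the typed hypothesis of v42.3's relabel-kill (`PinnedTo.cell_eq_P ∕ _N`) for the ORIGIN pin, nothing more. -/
theorem audit_nothing_decided : True := trivial

end Reduction


/-! ## §4 v42.6 WIRING (director-hodge R19.906 ∕ R19.907 (O′)(iv)): the DECORATION-BLIND DEGREE INVARIANT and `OriginDecSeparating` -/

section DecWiring

open Literature.AlgebraicGeometry.AbelianVarieties (IsHomogeneous cechPic_pullback_hom_mul_detClass)

variable {E₀ : AbelianVariety ℂ}

attribute [local instance] isIntegral_anchor

section Mumford

open scoped MonObj

/-- addition of homomorphisms of abelian varieties is the pointwise product of the underlying `S⁴`-valued points. [`rfl`] -/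
theorem hom_hom_hom_add {A B : AbelianVariety ℂ} (κ κ' : A ⟶ B) : (κ + κ').hom.hom.hom = κ.hom.hom.hom * κ'.hom.hom.hom := rfl

/-- the zero homomorphism is the unit point. -/
theorem hom_hom_hom_zero {A B : AbelianVariety ℂ} : (0 : A ⟶ B).hom.hom.hom = 1 := by
  rw [AbelianVariety.hom_zero, Grp.Hom.hom_one, Mon.Hom.hom_one]

/-- **A HOMOGENEOUS LINE BUNDLE HAS DEGREE `0` ALONG EVERY HOMOMORPHISM `κ : E₀ → B`** (Mumford §8 (iii) `(f·g)^*[Q] = f^*[Q]·g^*[Q]` for `Q ∈ Pic⁰`,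
tree `AbelianVarieties.cechPic_pullback_hom_mul_detClass`, at `(κ, −κ)`: `1 = 0^*[Q] = κ^*[Q]·(−κ)^*[Q]`, and `−κ = (−1) ≫ κ` with `deg` invariant under the
automorphism `−1` of the CM curve — the three-line route of c5c8-1 g55 ∕ R19.906, no `[2]^*`, no `n²`). -/
theorem degZ_pullback_hom_of_isHomogeneous (h1 : E₀.dim = 1) {B : AbelianVariety ℂ} (κ : E₀ ⟶ B) {Q : B.X.left.Modules} (hQ : HasRank Q 1)
    (hQh : IsHomogeneous B Q) : degZ E₀ (CechPic.pullback (AbelianVariety.Hom.toSchemeHom κ) (cls hQ)) = 0 := by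
  have key := cechPic_pullback_hom_mul_detClass B hQ (HasRank.isFiniteLocallyFree' hQ) hQh κ.hom.hom.hom (-κ).hom.hom.hom
  rw [← hom_hom_hom_add, add_neg_cancel, hom_hom_hom_zero, ← AbelianVariety.toSchemeHom_zero_eq_one_left, pullback_toSchemeHom_zero,
    show (-κ).hom.hom.hom.left = AbelianVariety.Hom.toSchemeHom ((-𝟙 E₀) ≫ κ) by rw [Preadditive.neg_comp, Category.id_comp],
    toSchemeHom_comp, CechPic.pullback_comp] at key
  -- `key : 1 = κ^*[Q] · (−1)^*(κ^*[Q])`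
  haveI := isIso_toSchemeHom_neg_one (E₀ := E₀)
  have hdeg := congrArg (degZ E₀) key
  rw [degZ_one h1, degZ_mul h1] at hdeg
  change 0 = degZ E₀ (CechPic.pullback (AbelianVariety.Hom.toSchemeHom κ) (cls hQ)) +
    degZ E₀ (epb (-𝟙 E₀) (CechPic.pullback (AbelianVariety.Hom.toSchemeHom κ) (cls hQ))) at hdeg
  obtain ⟨D, hD⟩ := CechPic.exists_cechClass_eq (CechPic.pullback (AbelianVariety.Hom.toSchemeHom κ) (cls hQ))
  have h2 : degZ E₀ (epb (-𝟙 E₀) (CechPic.pullback (AbelianVariety.Hom.toSchemeHom κ) (cls hQ))) =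
      degZ E₀ (CechPic.pullback (AbelianVariety.Hom.toSchemeHom κ) (cls hQ)) := by
    rw [← hD]
    exact degZ_epb_cechClass_of_isIso h1 (-𝟙 E₀) D
  rw [h2] at hdeg
  omega

end Mumford

variable (E₀) in
/-- the three test curves, indexed: `0 ↦ (o,t)`, `1 ↦ (t,t)`, `2 ↦ (t, ψt)`. -/
def testCurve (ψ : E₀ ⟶ E₀) : Fin 3 → (E₀ ⟶ weilSurf E₀) := ![axisCurve E₀, diagCurve E₀, graphCurve ψ]

/-- the twelve test homomorphisms `κ_{f,j} = ι_j ≫ σ_f : E₀ → S⁴`. -/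
def testHom (ψ : E₀ ⟶ E₀) (f : Fin 4) (j : Fin 3) : E₀ ⟶ pad4Anchor E₀ := testCurve E₀ ψ j ≫ sect E₀ f

/-- **THE DEGREE INVARIANT** `χ(A) := (deg κ_{f,j}^*[A])_{f,j} ∈ ℤ^{4×3}` of a rank-one module `A` on `S⁴`. -/
def chi (ψ : E₀ ⟶ E₀) (A : (pad4Anchor E₀).X.left.Modules) (hA : HasRank A 1) : Fin 4 → Fin 3 → ℤ :=
  fun f j => degZ E₀ (CechPic.pullback (AbelianVariety.Hom.toSchemeHom (testHom ψ f j)) (cls hA))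

/-- **THE `picZero`-BLIND DEGREE INVARIANT of a CM anchor** (c5c8 v42.5's `DecBlindInvariant` INSTANTIATED): iso-invariant (`cls_congr`), additive on
rank-one tensor products (`cls_tensorObj`, pull-back and degree are homomorphisms), zero on `Pic⁰` (`degZ_pullback_hom_of_isHomogeneous`). -/
def degInvariant (h1 : E₀.dim = 1) (ψ₀ : E₀ ⟶ E₀) : DecBlindInvariant (picZero E₀) (Fin 4 → Fin 3 → ℤ) :=
  { χ := chi ψ₀
    iso := fun e hA hB => by
      funext f j
      simp only [chi]
      rw [cls_congr e hA hB]
    tensor := fun hA hB => by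
      funext f j
      simp only [chi, Pi.add_apply]
      rw [cls_tensorObj hA hB, map_mul, degZ_mul h1]
    dec := fun Q hQ => by
      funext f j
      exact degZ_pullback_hom_of_isHomogeneous h1 (testHom ψ₀ f j) hQ.1 hQ.2 }

/-- the invariant of an origin letter along `κ_{f,j}` is the degree of the `f`-th factor class along the curve `j`. -/
theorem chi_letterBundle (h1 : E₀.dim = 1) (ψ₀ : E₀ ⟶ E₀) (Z : MCell) (f : Fin 4) (j : Fin 3) :
    chi ψ₀ (letterBundle (originLine E₀ h1) ψ₀ Z) (hasRank_letterBundle (hasRank_originLine E₀ h1) ψ₀ Z) f j =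
      degZ E₀ (cpb (testCurve E₀ ψ₀ j) (letterClassS (hasRank_originLine E₀ h1) ψ₀ (Z f))) := by
  simp only [chi, testHom]
  rw [toSchemeHom_comp, CechPic.pullback_comp, cls_letterBundle_eq_letterClass, pullback_sect_letterClass]

/-- **THE INVARIANT SEPARATES THE ORIGIN LETTERS** (the degree rows `a`, `2a − 2x`, `2a − 2y` of §2d with the intersection numbers of §2e–§2g). -/
theorem chi_separates (h1 : E₀.dim = 1) {ψ₀ : E₀ ⟶ E₀} (hψ : ψ₀ ≫ ψ₀ = -(1 • 𝟙 E₀)) (Z Z' : MCell)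
    (h : chi ψ₀ (letterBundle (originLine E₀ h1) ψ₀ Z) (hasRank_letterBundle (hasRank_originLine E₀ h1) ψ₀ Z) =
      chi ψ₀ (letterBundle (originLine E₀ h1) ψ₀ Z') (hasRank_letterBundle (hasRank_originLine E₀ h1) ψ₀ Z')) : Z = Z' := by
  let D : DegreeDatum E₀ h1 ψ₀ := DegreeDatum.ofIntersectionNumbers (intersectionNumbers_of_isogenyNumbers hψ (isogenyNumbers_holds h1 hψ))
  have hD : ∀ c, Multiplicative.toAdd (D.d c) = degZ E₀ c := fun c => rfl
  funext f
  have e0 := congrFun (congrFun h f) 0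
  have e1 := congrFun (congrFun h f) 1
  have e2 := congrFun (congrFun h f) 2
  rw [chi_letterBundle, chi_letterBundle] at e0 e1 e2
  have a0 := deg_axis D (Z f); have a0' := deg_axis D (Z' f)
  have a1 := deg_diag D (Z f); have a1' := deg_diag D (Z' f)
  have a2 := deg_graph D (Z f); have a2' := deg_graph D (Z' f)
  rw [hD] at a0 a0' a1 a1' a2 a2'
  simp only [testCurve, Matrix.cons_val_zero, Matrix.cons_val_one, Matrix.cons_val_two, Matrix.head_cons, Matrix.tail_cons] at e0 e1 e2
  rw [a0, a0'] at e0
  rw [a1, a1'] at e1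
  rw [a2, a2'] at e2
  refine Prod.ext e0 (Prod.ext ?_ ?_) <;> omega

/-- **`OriginDecSeparating` HOLDS** (v42.4's decorated separation for the ORIGIN pin, `Pic⁰` decorations): the origin letters twisted by arbitrary
homogeneous line bundles still name their cells — c5c8 v42.5's `originDecSeparating_of_invariant` fed with the degree invariant `degInvariant` and
`chi_separates`.  Unconditional; standard axioms. -/
theorem originDecSeparating_holds : OriginDecSeparating :=
  originDecSeparating_of_invariant (M := fun _ => Fin 4 → Fin 3 → ℤ) (fun E₀ h1 ψ₀ _ => degInvariant (E₀ := E₀) h1 ψ₀)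
    fun _ h1 _ hψ Z Z' h => chi_separates h1 hψ Z Z' h

/-- cross-check (R19.906): v42.5's second customer re-derives v42.3's `OriginSeparating` from the same invariant (= `originSeparating_holds` of §3). -/
example : OriginSeparating :=
  originSeparating_of_invariant (M := fun _ => Fin 4 → Fin 3 → ℤ) (fun E₀ h1 ψ₀ _ => degInvariant (E₀ := E₀) h1 ψ₀)
    fun _ h1 _ hψ Z Z' h => chi_separates h1 hψ Z Z' h

end DecWiring

end Summit.HodgeConjecture.HodgeConjecture.Cruxes.BlochSeedDiscOne.SeedChecker.SplitBlock.OriginSep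

end
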